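import Literature.Analysis.PDE.EllipticSmoothBootstrapStep
import Literature.Analysis.PDE.EllipticSmoothBootstrapData
import Literature.Analysis.Calculus.DifferenceQuotientHolder
import HarnessLib

/-!
# Frozen symbol coefficients of a fully nonlinear second-order equation

Topic `Literature/Analysis/PDE`. Algebraic and metric bookkeeping for the difference-quotient
regularity step `C^{2,α} ⇒ C^{3,α}` of Gilbarg–Trudinger (2001), Lemma 17.16 (file
`Literature/Analysis/PDE/DifferenceQuotientRegularity.lean`). There the equation
`H(c(y), cjet₂ v(y)) = 0` is subtracted from its translate and "frozen" along the segment between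
the two data points, which produces for the difference quotient `v_h` a LINEAR equation
`A_y (c_h(y), cjet₂ v_h(y)) = 0` with a continuous linear functional
`A_y : P × CJet ι 2 →L[ℝ] ℝ` (the segment integral of `DH`). This file turns such a functional
equation into the input of the tree's interior Schauder estimate
(`Literature.Analysis.PDE.exists_schauder_interior_ball_of_holder`).

The coefficients of the frozen equation are the symmetrised top-order symbol `symCoef G a b w` of
`Literature/Analysis/PDE/EllipticSmoothBootstrapStep.lean` taken for the CONSTANT-COEFFICIENT
structure function `G = A₀ ∘ Prod.snd : E × P × CJet ι 2 → ℝ` (whose derivative at every point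
`w` is `A₀ ∘ snd`, so that `topSym G w X = A₀ (0, single₂ X)`, `topSym_comp_snd`); this lets us
reuse `symCoef_comm`, `sum_symCoef_mul`, `symCoef_lower` verbatim. New here:

* `norm_symCoef_comp_snd_le`, `symCoef_comp_snd_upper`, `symCoef_comp_snd_lower` — the bounds
  `|ãᵃᵇ| ≤ ‖A₀‖`, `∑ ãᵃᵇ ξ_a ξ_b ≤ card(ι) ‖A₀‖ |ξ|²` and the ellipticity of `ã` from the
  ellipticity of `A₀` on rank-one top-slot jets;
* `holderOnWith_symCoef_comp_snd` — Hölder dependence on a parameter `y ↦ A y`;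
* `sum_symCoef_comp_snd_mul_iteratedFDeriv_two_eq` — **the linear equation for the unknown**:
  if `A₀ (p, cjet₂ u(y)) = 0` and `u` is `C²` at `y`, then
  `∑ ãᵃᵇ D²u(y)(e_a, e_b) = -A₀ (p, jetPad (cjet₁ u(y)))`, whose right-hand side involves the
  `1`-jet of `u` only;
* jet bookkeeping: `jetPad_trunc_add_single_last` (a jet is its zero-padded truncation plus its
  top slot), `norm_jetPad_le`, `norm_topInj_le`, and the coordinate jets of difference quotients
  (`cjetOf_diffQuot`);
* Hölder bounds of `D⁰f`, `D¹f` from those of `f`, `Df` (`holderOnWith_iteratedFDeriv_zero`,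
  `holderOnWith_iteratedFDeriv_one_of_fderiv`), the converse direction of
  `Literature/Analysis/Calculus/DifferenceQuotientHolder.lean`.

No definition is introduced. Everything is proved; no named facts.

## References

* D. Gilbarg, N. S. Trudinger, *Elliptic Partial Differential Equations of Second Order*,
  Classics in Mathematics, Springer 2001, §17.4, proof of Lemma 17.16. [GilbargTrudinger2001]
-/

noncomputable section

open scoped ContDiff Topology NNReal InnerProductSpace
open Set Function Metric
open Literature.Analysis.Calculus Literature.Analysis.FunctionSpaces

namespace Literature.Analysis.PDE

variable {ι : Type*} [Fintype ι] [DecidableEq ι] {E : Type*} [NormedAddCommGroup E]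
  [InnerProductSpace ℝ E]
variable {P : Type*} [NormedAddCommGroup P] [NormedSpace ℝ P]

/-! ### Jet bookkeeping -/

section Jets

omit [Fintype ι] [DecidableEq ι] in
/-- **A jet is its zero-padded truncation plus its top slot**:
`jetPad (trunc J) + single_{m+1} (J_{m+1}) = J`. [folklore] -/
theorem jetPad_trunc_add_single_last (m : ℕ) (J : CJet ι (m + 1)) :
    jetPad ι m (CJet.trunc ι m J) + Pi.single (Fin.last (m + 1)) (J (Fin.last (m + 1))) = J := by
  funext j I
  simp only [Pi.add_apply]
  by_cases hj : (j : ℕ) < m + 1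
  · have hne : j ≠ Fin.last (m + 1) := fun h => by simp [h] at hj
    rw [Pi.single_eq_of_ne hne, Pi.zero_apply, add_zero, jetPad_apply_of_lt m _ _ hj,
      CJet.trunc_apply]
    rfl
  · obtain rfl : j = Fin.last (m + 1) :=
      Fin.ext (by have := j.isLt; simp only [Fin.val_last]; omega)
    rw [Pi.single_eq_same, jetPad_apply_of_not_lt m _ _ hj, zero_add]

omit [DecidableEq ι] in
/-- Zero-padding does not increase the (sup) norm. [folklore] -/
theorem norm_jetPad_le (m : ℕ) (J : CJet ι m) : ‖jetPad ι m J‖ ≤ ‖J‖ := by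
  refine (pi_norm_le_iff_of_nonneg (norm_nonneg _)).2 fun j =>
    (pi_norm_le_iff_of_nonneg (norm_nonneg _)).2 fun I => ?_
  by_cases hj : (j : ℕ) < m + 1
  · rw [jetPad_apply_of_lt m J j hj]
    exact (norm_le_pi_norm _ I).trans (norm_le_pi_norm J _)
  · rw [jetPad_apply_of_not_lt m J j hj, norm_zero]
    exact norm_nonneg _

omit [DecidableEq ι] in
/-- Zero-padding is a contraction: `‖jetPad J - jetPad J'‖ ≤ ‖J - J'‖`. [folklore] -/
theorem norm_jetPad_sub_le (m : ℕ) (J J' : CJet ι m) :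
    ‖jetPad ι m J - jetPad ι m J'‖ ≤ ‖J - J'‖ := by
  rw [← map_sub]
  exact norm_jetPad_le m _

omit [DecidableEq ι] [NormedSpace ℝ P] in
/-- The top-slot injection does not increase the norm: `‖(0, single₂ X)‖ ≤ ‖X‖`. [folklore] -/
theorem norm_topInj_le (X : (Fin 2 → ι) → ℝ) :
    ‖((0 : P), (Pi.single (Fin.last 2) X : CJet ι 2))‖ ≤ ‖X‖ := by
  rw [Prod.norm_def, norm_zero]
  simp only [max_le_iff, norm_nonneg, true_and]
  refine (pi_norm_le_iff_of_nonneg (norm_nonneg _)).2 fun j => ?_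
  by_cases hj : j = Fin.last 2
  · subst hj
    rw [Pi.single_eq_same]
    exact le_rfl
  · rw [Pi.single_eq_of_ne hj, norm_zero]
    exact norm_nonneg _

/-- The elementary directions have norm `≤ 1`. [folklore] -/
theorem norm_singleTwo_le (a b : ι) : ‖(Pi.single ![a, b] (1 : ℝ) : (Fin 2 → ι) → ℝ)‖ ≤ 1 := by
  refine (pi_norm_le_iff_of_nonneg zero_le_one).2 fun I => ?_
  by_cases hI : I = ![a, b]
  · subst hI
    simp
  · rw [Pi.single_eq_of_ne hI]
    simp

omit [NormedSpace ℝ P] in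
/-- `‖(0, single₂ δ₂^{ab})‖ ≤ 1`. [folklore] -/
theorem norm_topInj_singleTwo_le (a b : ι) :
    ‖((0 : P), (Pi.single (Fin.last 2) (Pi.single ![a, b] (1 : ℝ)) : CJet ι 2))‖ ≤ 1 :=
  (norm_topInj_le (P := P) _).trans (norm_singleTwo_le a b)

omit [DecidableEq ι] in
/-- **Coordinate jets of difference quotients**: if `u` is `Cᵐ` at `y` and at `y + h e` then
`cjet_m (Δₕᵉ u)(y) = h⁻¹ • (cjet_m u (y + h e) - cjet_m u (y))` (the jet map is linear in the
function, `Literature.Analysis.Calculus.iteratedFDeriv_diffQuot`). [folklore] -/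
theorem cjetOf_diffQuot (bE : OrthonormalBasis ι ℝ E) {m : ℕ} {u : E → ℝ} {y e : E} {h : ℝ}
    (hy : ContDiffAt ℝ m u y) (hye : ContDiffAt ℝ m u (y + h • e)) :
    cjetOf bE m (fun y => h⁻¹ • (u (y + h • e) - u y)) y =
      h⁻¹ • (cjetOf bE m u (y + h • e) - cjetOf bE m u y) := by
  funext j I
  have hj : ((j : ℕ) : WithTop ℕ∞) ≤ (m : WithTop ℕ∞) := by exact_mod_cast Fin.is_le j
  simp only [Pi.smul_apply, Pi.sub_apply, cjetOf_apply]
  rw [iteratedFDeriv_diffQuot (hy.of_le hj) (hye.of_le hj)]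
  rfl

end Jets

/-! ### Hölder bounds of `D⁰f`, `D¹f` from those of `f`, `Df` -/

section Transfer

variable {F : Type*} [NormedAddCommGroup F] [NormedSpace ℝ F]

omit [InnerProductSpace ℝ E] in
/-- A Hölder bound of `f` is a Hölder bound of `D⁰f` (same constant; `D⁰f(x)() = f x`).
[folklore] -/
theorem holderOnWith_iteratedFDeriv_zero [NormedSpace ℝ E] {f : E → F} {s : Set E} {C r : ℝ≥0}
    (hf : HolderOnWith C r f s) : HolderOnWith C r (iteratedFDeriv ℝ 0 f) s := by
  refine holderOnWith_of_norm_sub_le_norm_sub (fun x _ y _ => ?_) hf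
  refine ContinuousMultilinearMap.opNorm_le_bound (norm_nonneg _) fun m => ?_
  simp only [sub_apply, iteratedFDeriv_zero_apply,
    Finset.univ_eq_empty, Finset.prod_empty, mul_one, le_refl]

omit [InnerProductSpace ℝ E] in
/-- A Hölder bound of `Df` is a Hölder bound of `D¹f` (same constant; `D¹f(x)(m) = Df(x)(m 0)`).
[folklore] -/
theorem holderOnWith_iteratedFDeriv_one_of_fderiv [NormedSpace ℝ E] {f : E → F} {s : Set E}
    {C r : ℝ≥0} (hf : HolderOnWith C r (fderiv ℝ f) s) :
    HolderOnWith C r (iteratedFDeriv ℝ 1 f) s := by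
  refine holderOnWith_of_norm_sub_le_norm_sub (fun x _ y _ => ?_) hf
  refine ContinuousMultilinearMap.opNorm_le_bound (norm_nonneg _) fun m => ?_
  simp only [sub_apply, iteratedFDeriv_one_apply, Fin.prod_univ_one]
  rw [← sub_apply]
  exact ContinuousLinearMap.le_opNorm _ _

end Transfer

/-! ### The frozen coefficients of a functional: `symCoef (A₀ ∘ snd)` -/

section Symbol

omit [DecidableEq ι] in
/-- The tuple of basis vectors indexed by `I : Fin 2 → ι` is the pair `(e_{I 0}, e_{I 1})`.
[folklore] -/
theorem basisTuple_two_eq (bE : OrthonormalBasis ι ℝ E) (I : Fin 2 → ι) :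
    (fun k => bE (I k)) = ![bE (I 0), bE (I 1)] := by
  funext k
  fin_cases k <;> rfl

omit [Fintype ι] [DecidableEq ι] in
/-- **The symbol of a constant-coefficient structure function**: for a functional `A₀` and
`G = A₀ ∘ snd`, `topSym G w X = A₀ (0, single₂ X)` at every `w` (the derivative of a continuous
linear map is itself). [folklore] -/
theorem topSym_comp_snd (A₀ : P × CJet ι 2 →L[ℝ] ℝ) (w : E × P × CJet ι 2) (X : (Fin 2 → ι) → ℝ) :
    topSym (⇑A₀ ∘ Prod.snd) w X = A₀ ((0 : P), Pi.single (Fin.last 2) X) := by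
  rw [topSym_apply,
    show (⇑A₀ ∘ Prod.snd : E × P × CJet ι 2 → ℝ) =
      ⇑(A₀.comp (ContinuousLinearMap.snd ℝ E (P × CJet ι 2))) from rfl,
    ContinuousLinearMap.fderiv]
  rfl

omit [Fintype ι] in
/-- The frozen coefficients `symCoef (A₀ ∘ snd) a b w` do not depend on the base point `w`.
[folklore] -/
theorem symCoef_comp_snd_eq (A₀ : P × CJet ι 2 →L[ℝ] ℝ) (a b : ι) (w w' : E × P × CJet ι 2) :
    symCoef (⇑A₀ ∘ Prod.snd) a b w = symCoef (⇑A₀ ∘ Prod.snd) a b w' := by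
  simp only [symCoef, topSym_comp_snd]

/-- **The frozen coefficients are bounded by the norm of the functional**: `|ãᵃᵇ| ≤ ‖A₀‖`
(the test vectors `(0, single₂ δ₂^{ab})` have norm `≤ 1`). [folklore] -/
theorem norm_symCoef_comp_snd_le (A₀ : P × CJet ι 2 →L[ℝ] ℝ) (a b : ι) (w : E × P × CJet ι 2) :
    ‖symCoef (⇑A₀ ∘ Prod.snd) a b w‖ ≤ ‖A₀‖ := by
  have h : ∀ a' b' : ι, ‖topSym (⇑A₀ ∘ Prod.snd) w (Pi.single ![a', b'] 1)‖ ≤ ‖A₀‖ :=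
    fun a' b' => by
      rw [topSym_comp_snd]
      exact (A₀.le_opNorm _).trans
        (mul_le_of_le_one_right (norm_nonneg _) (norm_topInj_singleTwo_le _ _))
  rw [symCoef, norm_div, Real.norm_two, div_le_iff₀ (by norm_num : (0 : ℝ) < 2)]
  calc ‖topSym (⇑A₀ ∘ Prod.snd) w (Pi.single ![a, b] 1) +
          topSym (⇑A₀ ∘ Prod.snd) w (Pi.single ![b, a] 1)‖
        ≤ ‖A₀‖ + ‖A₀‖ := (norm_add_le _ _).trans (add_le_add (h a b) (h b a))
    _ = ‖A₀‖ * 2 := by ring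

/-- **Upper ellipticity bound of the frozen coefficients**:
`∑ ãᵃᵇ ξ_a ξ_b ≤ card(ι) ‖A₀‖ ∑ ξ_a²`. [folklore] -/
theorem symCoef_comp_snd_upper (A₀ : P × CJet ι 2 →L[ℝ] ℝ) (w : E × P × CJet ι 2) (ξ : ι → ℝ) :
    ∑ a, ∑ b, symCoef (⇑A₀ ∘ Prod.snd) a b w * ξ a * ξ b ≤ Fintype.card ι * ‖A₀‖ * ∑ a, ξ a ^ 2 :=
  sum_sum_mul_mul_le (fun a b => norm_symCoef_comp_snd_le A₀ a b w) ξ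

/-- **Ellipticity of the frozen coefficients** from the ellipticity of the functional on rank-one
top-slot jets `I ↦ η(e_{I 0}) η(e_{I 1})`: `λ ∑ ξ_a² ≤ ∑ ãᵃᵇ ξ_a ξ_b`. [folklore] -/
theorem symCoef_comp_snd_lower (bE : OrthonormalBasis ι ℝ E) (A₀ : P × CJet ι 2 →L[ℝ] ℝ)
    (w : E × P × CJet ι 2) {l : ℝ}
    (hA : ∀ η : E →L[ℝ] ℝ, l * ‖η‖ ^ 2 ≤
      A₀ ((0 : P), Pi.single (Fin.last 2) (fun I : Fin 2 → ι => η (bE (I 0)) * η (bE (I 1)))))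
    (ξ : ι → ℝ) : l * ∑ a, ξ a ^ 2 ≤ ∑ a, ∑ b, symCoef (⇑A₀ ∘ Prod.snd) a b w * ξ a * ξ b :=
  symCoef_lower bE _ w (fun η => by rw [topSym_comp_snd]; exact hA η) ξ

/-- **Hölder dependence of the frozen coefficients on a parameter**: if `y ↦ A y` is
`(K, r)`-Hölder on `s` (operator norm), so is `y ↦ ãᵃᵇ(A y)` (same constant). [folklore] -/
theorem holderOnWith_symCoef_comp_snd {X : Type*} [PseudoMetricSpace X]
    {A : X → P × CJet ι 2 →L[ℝ] ℝ} {s : Set X} {K r : ℝ≥0} (hA : HolderOnWith K r A s) (a b : ι)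
    (w : E × P × CJet ι 2) :
    HolderOnWith K r (fun y => symCoef (⇑(A y) ∘ Prod.snd) a b w) s := by
  refine holderOnWith_of_norm_sub_le_norm_sub (fun x _ y _ => ?_) hA
  have h : ∀ c : Fin 2 → ι, ‖topSym (⇑(A x) ∘ Prod.snd) w (Pi.single c 1) -
      topSym (⇑(A y) ∘ Prod.snd) w (Pi.single c 1)‖ ≤ ‖A x - A y‖ := fun c => by
    have hc : ‖((0 : P), (Pi.single (Fin.last 2) (Pi.single c (1 : ℝ)) : CJet ι 2))‖ ≤ 1 := by
      refine (norm_topInj_le (P := P) _).trans ((pi_norm_le_iff_of_nonneg zero_le_one).2 ?_)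
      intro I
      by_cases hI : I = c
      · subst hI; simp
      · rw [Pi.single_eq_of_ne hI]; simp
    rw [topSym_comp_snd, topSym_comp_snd, ← sub_apply]
    exact ((A x - A y).le_opNorm _).trans (mul_le_of_le_one_right (norm_nonneg _) hc)
  simp only [symCoef]
  rw [← sub_div, norm_div, Real.norm_two, div_le_iff₀ (by norm_num : (0 : ℝ) < 2)]
  calc ‖topSym (⇑(A x) ∘ Prod.snd) w (Pi.single ![a, b] 1) +
            topSym (⇑(A x) ∘ Prod.snd) w (Pi.single ![b, a] 1) -
          (topSym (⇑(A y) ∘ Prod.snd) w (Pi.single ![a, b] 1) +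
            topSym (⇑(A y) ∘ Prod.snd) w (Pi.single ![b, a] 1))‖
        = ‖(topSym (⇑(A x) ∘ Prod.snd) w (Pi.single ![a, b] 1) -
              topSym (⇑(A y) ∘ Prod.snd) w (Pi.single ![a, b] 1)) +
            (topSym (⇑(A x) ∘ Prod.snd) w (Pi.single ![b, a] 1) -
              topSym (⇑(A y) ∘ Prod.snd) w (Pi.single ![b, a] 1))‖ := by abel_nf
    _ ≤ ‖A x - A y‖ + ‖A x - A y‖ := (norm_add_le _ _).trans (add_le_add (h _) (h _))
    _ = ‖A x - A y‖ * 2 := by ring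

/-- **The linear equation for the unknown.** If `A₀ (p, cjet₂ u(y)) = 0` for a functional `A₀`
and `u` is `C²` at `y`, then, with the frozen coefficients `ãᵃᵇ = symCoef (A₀ ∘ snd) a b w`,
`∑_{ab} ãᵃᵇ D²u(y)(e_a, e_b) = -A₀ (p, jetPad (cjet₁ u(y)))`: split the `2`-jet into its
zero-padded `1`-jet and its (symmetric) top slot (`jetPad_trunc_add_single_last`,
`sum_symCoef_mul`). This is the form in which the interior Schauder estimate applies to
difference quotients (Gilbarg–Trudinger 2001, §17.4). [folklore] -/
theorem sum_symCoef_comp_snd_mul_iteratedFDeriv_two_eq (bE : OrthonormalBasis ι ℝ E)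
    (A₀ : P × CJet ι 2 →L[ℝ] ℝ) {u : E → ℝ} {y : E} (hu : ContDiffAt ℝ 2 u y) (p : P)
    (h0 : A₀ (p, cjetOf bE 2 u y) = 0) (w : E × P × CJet ι 2) :
    ∑ a, ∑ b, symCoef (⇑A₀ ∘ Prod.snd) a b w * iteratedFDeriv ℝ 2 u y ![bE a, bE b] =
      -A₀ (p, jetPad ι 1 (cjetOf bE 1 u y)) := by
  -- symmetry of `D²u(y)`
  have hq : ∀ a b, iteratedFDeriv ℝ 2 u y ![bE a, bE b] = iteratedFDeriv ℝ 2 u y ![bE b, bE a] :=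
    fun a b => by
      rw [iteratedFDeriv_two_apply, iteratedFDeriv_two_apply]
      simp only [Matrix.cons_val_zero, Matrix.cons_val_one]
      exact (hu.isSymmSndFDerivAt (by simp [minSmoothness_of_isRCLikeNormedField])).eq _ _
  rw [sum_symCoef_mul _ w hq, topSym_comp_snd]
  -- the top slot of `cjet₂ u(y)`
  have htop : (fun I : Fin 2 → ι => iteratedFDeriv ℝ 2 u y ![bE (I 0), bE (I 1)]) =
      cjetOf bE 2 u y (Fin.last 2) := by
    funext I
    rw [← basisTuple_two_eq bE I]
    rfl
  -- the decomposition of `(p, cjet₂ u(y))`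
  have hsplit : ((p, cjetOf bE 2 u y) : P × CJet ι 2) =
      (p, jetPad ι 1 (cjetOf bE 1 u y)) +
        ((0 : P), (Pi.single (Fin.last 2) (cjetOf bE 2 u y (Fin.last 2)) : CJet ι 2)) := by
    rw [Prod.mk_add_mk, add_zero, ← CJet.trunc_cjetOf bE 1 u y, jetPad_trunc_add_single_last]
  rw [htop, eq_neg_iff_add_eq_zero, add_comm, ← map_add, ← hsplit, h0]

end Symbol

end Literature.Analysis.PDE
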